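import Mathlib
import Summits.Ventures.PercRepro2.Defs
import Summits.Ventures.PercRepro2.Graph
import Summits.Ventures.PercRepro2.Harris
import Summits.Ventures.PercRepro2.RowC1Cross

/-!
# The cross term of row 2′C1 at an `a₁b`-edge is nonnegative — unconditionally
(blind cell PercRepro2, p2 g34; proofs/P2-G34-ROOT.md §11)

At an edge `e = a₁b` (the root `a₁` joined to the mark `b`) opening `e` puts `b ∈ L`, hence
`b ∈ U` surely and `b ∈ H` impossible on `Q` (`b ↔ a₁` and `b ↔ a₂` would connect the roots):
`P¹(Q, bH) = 0` (`prob_update_one_bHQ_eq_zero`) and `P¹(Q, oU, bU) = P¹(Q, oU)`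
(`prob_update_one_oUbUQ_eq_oUQ`).  The cross term collapses to
`c1Cross p e = P¹(Q, oU)·(P⁰(Q) − P⁰(Q, bH)) + P¹(Q)·P⁰(Q, oU, bU)`, a sum of two products of
nonnegative masses (`c1Cross_eq_of_a₁b_edge`, `c1Cross_nonneg_of_a₁b_edge`) — no induction
hypothesis needed: the second edge type at which `CrossNonneg` is a theorem (kit j334695: CROSS ≥ 0 on
89,391 / 89,391 `a₁b`-edges, and ≥ Row⁰ on all of them).  Std axioms.
-/

namespace Summit.Ventures.PercRepro2

namespace RowC1

section A1B

variable {V : Type*} {E : Type*} [Fintype E] [DecidableEq E] [Fintype V] [DecidableEq V]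
  {R : Type*} [Field R] [LinearOrder R] [IsStrictOrderedRing R]

omit [Fintype E] [DecidableEq E] [Fintype V] [DecidableEq V] [Field R] [LinearOrder R]
  [IsStrictOrderedRing R] in
/-- With `e = a₁b` open, `b ↔ a₁`; together with `b ↔ a₂` this connects the roots:
`(bH ∩ Q) ∩ openEdge e = ∅`. -/
lemma bHQ_inter_openEdge_eq_empty (ends : E → Sym2 V) {e : E} {a₁ b : V}
    (hends : ends e = s(a₁, b)) (a₂ : V) :
    (connEvent ends a₂ b ∩ (connEvent ends a₁ a₂)ᶜ) ∩ openEdge e = ∅ := by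
  ext ω
  simp only [Set.mem_inter_iff, Set.mem_compl_iff, mem_connEvent, mem_openEdge,
    Set.mem_empty_iff_false, iff_false, not_and]
  rintro ⟨hb, hQ⟩ he
  exact hQ (conn_trans (conn_of_openAdj ⟨e, he, hends⟩) (conn_symm hb))

omit [Fintype E] [DecidableEq E] [Fintype V] [DecidableEq V] [Field R] [LinearOrder R]
  [IsStrictOrderedRing R] in
/-- With `e = a₁b` open, `b ∈ U`: `(oU ∩ Q) ∩ openEdge e ⊆ oU ∩ bU ∩ Q`. -/
lemma oUQ_inter_openEdge_subset (ends : E → Sym2 V) {e : E} {a₁ b : V}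
    (hends : ends e = s(a₁, b)) (a₂ o : V) :
    ((connEvent ends a₁ o ∪ connEvent ends a₂ o) ∩ (connEvent ends a₁ a₂)ᶜ) ∩ openEdge e ⊆
      (connEvent ends a₁ o ∪ connEvent ends a₂ o) ∩ (connEvent ends a₁ b ∪ connEvent ends a₂ b) ∩
        (connEvent ends a₁ a₂)ᶜ := by
  rintro ω ⟨⟨hoU, hQ⟩, he⟩
  exact ⟨⟨hoU, Or.inl (conn_of_openAdj ⟨e, he, hends⟩)⟩, hQ⟩

omit [Fintype V] [DecidableEq V] [LinearOrder R] [IsStrictOrderedRing R] in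
/-- Under `p[e↦1]` with `e = a₁b`, `Q ∩ {b ∈ H}` is null. -/
lemma prob_update_one_bHQ_eq_zero (p : E → R) (ends : E → Sym2 V) {e : E} {a₁ b : V}
    (hends : ends e = s(a₁, b)) (a₂ : V) :
    prob (Function.update p e (1 : R)) (connEvent ends a₂ b ∩ (connEvent ends a₁ a₂)ᶜ) = 0 := by
  rw [← prob_update_one_inter_openEdge p _ e, bHQ_inter_openEdge_eq_empty ends hends a₂, prob_empty]

omit [Fintype V] [DecidableEq V] in
/-- Under `p[e↦1]` with `e = a₁b`, `b ∈ U` is sure: `P¹(Q, oU, bU) = P¹(Q, oU)`. -/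
lemma prob_update_one_oUbUQ_eq_oUQ (p : E → R) (hp : IsProbVec p) (ends : E → Sym2 V) {e : E}
    {a₁ b : V} (hends : ends e = s(a₁, b)) (a₂ o : V) :
    prob (Function.update p e (1 : R))
        ((connEvent ends a₁ o ∪ connEvent ends a₂ o) ∩
          (connEvent ends a₁ b ∪ connEvent ends a₂ b) ∩ (connEvent ends a₁ a₂)ᶜ) =
      prob (Function.update p e (1 : R))
        ((connEvent ends a₁ o ∪ connEvent ends a₂ o) ∩ (connEvent ends a₁ a₂)ᶜ) := by
  have hp' := hp.update e zero_le_one le_rfl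
  refine le_antisymm (prob_mono hp' ?_) ?_
  · rintro ω ⟨⟨hoU, _⟩, hQ⟩
    exact ⟨hoU, hQ⟩
  · calc prob (Function.update p e (1 : R))
          ((connEvent ends a₁ o ∪ connEvent ends a₂ o) ∩ (connEvent ends a₁ a₂)ᶜ)
        = prob (Function.update p e (1 : R))
            (((connEvent ends a₁ o ∪ connEvent ends a₂ o) ∩ (connEvent ends a₁ a₂)ᶜ) ∩
              openEdge e) := (prob_update_one_inter_openEdge p _ e).symm
      _ ≤ _ := prob_mono hp' (oUQ_inter_openEdge_subset ends hends a₂ o)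

omit [Fintype V] [DecidableEq V] in
/-- **The cross term at an `a₁b`-edge**:
`c1Cross p e = P¹(Q, oU)·(P⁰(Q) − P⁰(Q, bH)) + P¹(Q)·P⁰(Q, oU, bU)`. -/
theorem c1Cross_eq_of_a₁b_edge (p : E → R) (hp : IsProbVec p) (ends : E → Sym2 V) {e : E}
    {a₁ b : V} (hends : ends e = s(a₁, b)) (a₂ o : V) :
    c1Cross p ends a₁ a₂ o b e =
      prob (Function.update p e (1 : R))
          ((connEvent ends a₁ o ∪ connEvent ends a₂ o) ∩ (connEvent ends a₁ a₂)ᶜ) *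
        (prob (Function.update p e (0 : R)) (connEvent ends a₁ a₂)ᶜ -
          prob (Function.update p e (0 : R)) (connEvent ends a₂ b ∩ (connEvent ends a₁ a₂)ᶜ)) +
      prob (Function.update p e (1 : R)) (connEvent ends a₁ a₂)ᶜ *
        prob (Function.update p e (0 : R))
          ((connEvent ends a₁ o ∪ connEvent ends a₂ o) ∩
            (connEvent ends a₁ b ∪ connEvent ends a₂ b) ∩ (connEvent ends a₁ a₂)ᶜ) := by
  unfold c1Cross
  rw [prob_update_one_bHQ_eq_zero p ends hends a₂, prob_update_one_oUbUQ_eq_oUQ p hp ends hends a₂ o]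
  ring

omit [Fintype V] [DecidableEq V] in
/-- **The cross term at an `a₁b`-edge is nonnegative, unconditionally.** -/
theorem c1Cross_nonneg_of_a₁b_edge (p : E → R) (hp : IsProbVec p) (ends : E → Sym2 V) {e : E}
    {a₁ b : V} (hends : ends e = s(a₁, b)) (a₂ o : V) :
    0 ≤ c1Cross p ends a₁ a₂ o b e := by
  rw [c1Cross_eq_of_a₁b_edge p hp ends hends a₂ o]
  have hp0 := hp.update e le_rfl zero_le_one
  have hp1 := hp.update e zero_le_one le_rfl
  have h1 : 0 ≤ prob (Function.update p e (0 : R)) (connEvent ends a₁ a₂)ᶜ -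
      prob (Function.update p e (0 : R)) (connEvent ends a₂ b ∩ (connEvent ends a₁ a₂)ᶜ) :=
    sub_nonneg.2 (prob_mono hp0 Set.inter_subset_right)
  exact add_nonneg (mul_nonneg (prob_nonneg hp1 _) h1)
    (mul_nonneg (prob_nonneg hp1 _) (prob_nonneg hp0 _))

end A1B

end RowC1

end Summit.Ventures.PercRepro2
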